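import Summits.CriticalPhenomena.PercolationContinuityZ3.Theorems.PercNearOneGluingNoHeavyLowerTailAttachedChampion
import HarnessLib

/-!
# `NoHeavyLowerTail` (stmt-CriticalPhenomena-4575) — reshape of the attached-champion split:
# OBSERVER-DELETED form (XZ-H) + WITNESS TRANSFER (WT)

Lead of the crux, 2026-08-18 (second reshape).  Notation as in `…AttachedChampion.lean`: `μ_w = prodBernoulli w` on
`Fin n`, relays `A`, observer `o ∉ A`, level `j`, `N = |π(o)|`, `R_a = {|π(a)| ≤ j}`, `𝔸 = {1 ≤ N}`, `L = {1 ≤ N ≤ j}`, and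
`w ∖ o = fun e => if o ∈ e then 0 else w e` (observer deleted).

The earlier split `…AttachedChampionSplit.lean` used the two-relay transfer TR (`stub_transferAttached`):
"`μ_{w∖o}(R_a) ≤ μ_{w∖o}(R_q)` and `μ_w(R_q) ≤ μ_w(R_a)` imply `μ_w(R_q ∩ 𝔸) ≤ μ_w(R_a ∩ 𝔸)`".  **TR is false**: exact witness
`n = 7`, `o = 0`, `A = {1,5,6}`, `j = 1`, weights (k/10⁴) `(4,6):1768 (1,3):9461 (3,5):1323 (1,6):255 (4,5):8516 (0,4):8544
(2,6):1291 (1,2):9521 (0,2):2640`, `(a,q) = (5,1)`: `q` is the unique champion of `w ∖ o`, both hypotheses hold strictly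
(gaps 4.6e-3, 2.8e-3) and `μ_w(R_a ∩ 𝔸) − μ_w(R_q ∩ 𝔸) = −6.33e-3` (evidence `TR-REFUTED.md` on the item).  The order of the
attached lonelinesses is simply not determined by the two loneliness orders.  In the same instance `μ_w(L) = 0.4528` lies below
all three `μ_w(R_x ∩ 𝔸)`, so the statements that matter survive:

* **XZ-H** (hypothesis `hXZH`, registered stub `stub_attachedChampionDeleted`, unchanged): a level-`j` champion `q` of `w ∖ o`
  satisfies `μ_w(L) ≤ μ_w(R_q ∩ 𝔸)`.
* **WT** (hypothesis `hWT`, registered stub `stub_witnessTransfer`, replaces TR): if `q` is a champion of `w ∖ o`, `a ∈ A` has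
  `μ_w(R_q) ≤ μ_w(R_a)`, AND `μ_w(L) ≤ μ_w(R_q ∩ 𝔸)`, then `μ_w(L) ≤ μ_w(R_a ∩ 𝔸)` — the transfer now carries the
  light-attachment mass `μ_w(L)` itself (it is the THRESHOLD principle "every relay at least as lonely in `w` as the champion of
  `w ∖ o` is an XZ-witness", restricted to instances where XZ-H holds).  Census: 0 violations in 14 814 exact (a, q, j)-tests with
  all tied champions, corner families (uniform small weights, glued / pendant observer, {p, 1−p} mixtures) and slack climbs.
* `attachedChampion_of_deleted_of_witnessTransfer` : XZ-H ∧ WT ⇒ `stub_attachedChampion`;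
  `noHeavyLowerTail_of_deleted_of_witnessTransfer` : XZ-H ∧ WT ⇒ the crux.
-/

noncomputable section

namespace Summit.CriticalPhenomena.PercolationContinuityZ3.Theorems

open MeasureTheory Set Literature.Probability.LatticeModels Literature.Probability.Percolation
open scoped Classical BigOperators

open MergeStability in
/-- **XZ-H and WT imply the attached-champion inequality** (`stub_attachedChampion`): take a champion `q_H` of the
observer-deleted weights; XZ-H makes `q_H` a witness; WT transfers the witness property to the champion `q` of `w`, which is at
least as lonely in `w` as `q_H`. -/
theorem attachedChampion_of_deleted_of_witnessTransfer
    (hXZH : ∀ (n : ℕ) (w : Sym2 (Fin n) → unitInterval) (A : Finset (Fin n)) (o q : Fin n) (j : ℕ),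
      o ∉ A → q ∈ A →
      (∀ a ∈ A,
        (Literature.Probability.LatticeModels.prodBernoulli (fun e => if o ∈ e then 0 else w e)).real
          {ω : Literature.Probability.Percolation.BondConfig (Fin n) |
            (A.filter fun x => ω ∈ Literature.Probability.Percolation.openConn a x).card ≤ j} ≤
          (Literature.Probability.LatticeModels.prodBernoulli (fun e => if o ∈ e then 0 else w e)).real
          {ω : Literature.Probability.Percolation.BondConfig (Fin n) |
            (A.filter fun x => ω ∈ Literature.Probability.Percolation.openConn q x).card ≤ j}) →
      (Literature.Probability.LatticeModels.prodBernoulli w).real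
          {ω : Literature.Probability.Percolation.BondConfig (Fin n) |
            1 ≤ (A.filter fun x => ω ∈ Literature.Probability.Percolation.openConn o x).card ∧
              (A.filter fun x => ω ∈ Literature.Probability.Percolation.openConn o x).card ≤ j} ≤
        (Literature.Probability.LatticeModels.prodBernoulli w).real
          {ω : Literature.Probability.Percolation.BondConfig (Fin n) |
            (A.filter fun x => ω ∈ Literature.Probability.Percolation.openConn q x).card ≤ j ∧
              1 ≤ (A.filter fun x => ω ∈ Literature.Probability.Percolation.openConn o x).card})
    (hWT : ∀ (n : ℕ) (w : Sym2 (Fin n) → unitInterval) (A : Finset (Fin n)) (o a q : Fin n) (j : ℕ),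
      o ∉ A → a ∈ A → q ∈ A →
      (∀ b ∈ A,
        (Literature.Probability.LatticeModels.prodBernoulli (fun e => if o ∈ e then 0 else w e)).real
          {ω : Literature.Probability.Percolation.BondConfig (Fin n) |
            (A.filter fun x => ω ∈ Literature.Probability.Percolation.openConn b x).card ≤ j} ≤
          (Literature.Probability.LatticeModels.prodBernoulli (fun e => if o ∈ e then 0 else w e)).real
          {ω : Literature.Probability.Percolation.BondConfig (Fin n) |
            (A.filter fun x => ω ∈ Literature.Probability.Percolation.openConn q x).card ≤ j}) →
      (Literature.Probability.LatticeModels.prodBernoulli w).real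
          {ω : Literature.Probability.Percolation.BondConfig (Fin n) |
            (A.filter fun x => ω ∈ Literature.Probability.Percolation.openConn q x).card ≤ j} ≤
        (Literature.Probability.LatticeModels.prodBernoulli w).real
          {ω : Literature.Probability.Percolation.BondConfig (Fin n) |
            (A.filter fun x => ω ∈ Literature.Probability.Percolation.openConn a x).card ≤ j} →
      (Literature.Probability.LatticeModels.prodBernoulli w).real
          {ω : Literature.Probability.Percolation.BondConfig (Fin n) |
            1 ≤ (A.filter fun x => ω ∈ Literature.Probability.Percolation.openConn o x).card ∧
              (A.filter fun x => ω ∈ Literature.Probability.Percolation.openConn o x).card ≤ j} ≤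
        (Literature.Probability.LatticeModels.prodBernoulli w).real
          {ω : Literature.Probability.Percolation.BondConfig (Fin n) |
            (A.filter fun x => ω ∈ Literature.Probability.Percolation.openConn q x).card ≤ j ∧
              1 ≤ (A.filter fun x => ω ∈ Literature.Probability.Percolation.openConn o x).card} →
      (Literature.Probability.LatticeModels.prodBernoulli w).real
          {ω : Literature.Probability.Percolation.BondConfig (Fin n) |
            1 ≤ (A.filter fun x => ω ∈ Literature.Probability.Percolation.openConn o x).card ∧
              (A.filter fun x => ω ∈ Literature.Probability.Percolation.openConn o x).card ≤ j} ≤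
        (Literature.Probability.LatticeModels.prodBernoulli w).real
          {ω : Literature.Probability.Percolation.BondConfig (Fin n) |
            (A.filter fun x => ω ∈ Literature.Probability.Percolation.openConn a x).card ≤ j ∧
              1 ≤ (A.filter fun x => ω ∈ Literature.Probability.Percolation.openConn o x).card})
    (n : ℕ) (w : Sym2 (Fin n) → unitInterval) (A : Finset (Fin n)) (o q : Fin n) (j : ℕ)
    (ho : o ∉ A) (hq : q ∈ A)
    (hchamp : ∀ a ∈ A,
      (Literature.Probability.LatticeModels.prodBernoulli w).real
          {ω : Literature.Probability.Percolation.BondConfig (Fin n) |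
            (A.filter fun x => ω ∈ Literature.Probability.Percolation.openConn a x).card ≤ j} ≤
        (Literature.Probability.LatticeModels.prodBernoulli w).real
          {ω : Literature.Probability.Percolation.BondConfig (Fin n) |
            (A.filter fun x => ω ∈ Literature.Probability.Percolation.openConn q x).card ≤ j}) :
    (Literature.Probability.LatticeModels.prodBernoulli w).real
          {ω : Literature.Probability.Percolation.BondConfig (Fin n) |
            1 ≤ (A.filter fun x => ω ∈ Literature.Probability.Percolation.openConn o x).card ∧
              (A.filter fun x => ω ∈ Literature.Probability.Percolation.openConn o x).card ≤ j} ≤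
      (Literature.Probability.LatticeModels.prodBernoulli w).real
          {ω : Literature.Probability.Percolation.BondConfig (Fin n) |
            (A.filter fun x => ω ∈ Literature.Probability.Percolation.openConn q x).card ≤ j ∧
              1 ≤ (A.filter fun x => ω ∈ Literature.Probability.Percolation.openConn o x).card} := by
  obtain ⟨qH, hqH, hchampH⟩ := exists_champion (prodBernoulli (fun e => if o ∈ e then 0 else w e)) A ⟨q, hq⟩ j
  exact hWT n w A o q qH j ho hq hqH hchampH (hchamp qH hqH) (hXZH n w A o qH j ho hqH hchampH)

/-- **Corollary: XZ-H and WT close the crux `NoHeavyLowerTail`.** -/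
theorem noHeavyLowerTail_of_deleted_of_witnessTransfer
    (hXZH : ∀ (n : ℕ) (w : Sym2 (Fin n) → unitInterval) (A : Finset (Fin n)) (o q : Fin n) (j : ℕ),
      o ∉ A → q ∈ A →
      (∀ a ∈ A,
        (Literature.Probability.LatticeModels.prodBernoulli (fun e => if o ∈ e then 0 else w e)).real
          {ω : Literature.Probability.Percolation.BondConfig (Fin n) |
            (A.filter fun x => ω ∈ Literature.Probability.Percolation.openConn a x).card ≤ j} ≤
          (Literature.Probability.LatticeModels.prodBernoulli (fun e => if o ∈ e then 0 else w e)).real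
          {ω : Literature.Probability.Percolation.BondConfig (Fin n) |
            (A.filter fun x => ω ∈ Literature.Probability.Percolation.openConn q x).card ≤ j}) →
      (Literature.Probability.LatticeModels.prodBernoulli w).real
          {ω : Literature.Probability.Percolation.BondConfig (Fin n) |
            1 ≤ (A.filter fun x => ω ∈ Literature.Probability.Percolation.openConn o x).card ∧
              (A.filter fun x => ω ∈ Literature.Probability.Percolation.openConn o x).card ≤ j} ≤
        (Literature.Probability.LatticeModels.prodBernoulli w).real
          {ω : Literature.Probability.Percolation.BondConfig (Fin n) |
            (A.filter fun x => ω ∈ Literature.Probability.Percolation.openConn q x).card ≤ j ∧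
              1 ≤ (A.filter fun x => ω ∈ Literature.Probability.Percolation.openConn o x).card})
    (hWT : ∀ (n : ℕ) (w : Sym2 (Fin n) → unitInterval) (A : Finset (Fin n)) (o a q : Fin n) (j : ℕ),
      o ∉ A → a ∈ A → q ∈ A →
      (∀ b ∈ A,
        (Literature.Probability.LatticeModels.prodBernoulli (fun e => if o ∈ e then 0 else w e)).real
          {ω : Literature.Probability.Percolation.BondConfig (Fin n) |
            (A.filter fun x => ω ∈ Literature.Probability.Percolation.openConn b x).card ≤ j} ≤
          (Literature.Probability.LatticeModels.prodBernoulli (fun e => if o ∈ e then 0 else w e)).real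
          {ω : Literature.Probability.Percolation.BondConfig (Fin n) |
            (A.filter fun x => ω ∈ Literature.Probability.Percolation.openConn q x).card ≤ j}) →
      (Literature.Probability.LatticeModels.prodBernoulli w).real
          {ω : Literature.Probability.Percolation.BondConfig (Fin n) |
            (A.filter fun x => ω ∈ Literature.Probability.Percolation.openConn q x).card ≤ j} ≤
        (Literature.Probability.LatticeModels.prodBernoulli w).real
          {ω : Literature.Probability.Percolation.BondConfig (Fin n) |
            (A.filter fun x => ω ∈ Literature.Probability.Percolation.openConn a x).card ≤ j} →
      (Literature.Probability.LatticeModels.prodBernoulli w).real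
          {ω : Literature.Probability.Percolation.BondConfig (Fin n) |
            1 ≤ (A.filter fun x => ω ∈ Literature.Probability.Percolation.openConn o x).card ∧
              (A.filter fun x => ω ∈ Literature.Probability.Percolation.openConn o x).card ≤ j} ≤
        (Literature.Probability.LatticeModels.prodBernoulli w).real
          {ω : Literature.Probability.Percolation.BondConfig (Fin n) |
            (A.filter fun x => ω ∈ Literature.Probability.Percolation.openConn q x).card ≤ j ∧
              1 ≤ (A.filter fun x => ω ∈ Literature.Probability.Percolation.openConn o x).card} →
      (Literature.Probability.LatticeModels.prodBernoulli w).real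
          {ω : Literature.Probability.Percolation.BondConfig (Fin n) |
            1 ≤ (A.filter fun x => ω ∈ Literature.Probability.Percolation.openConn o x).card ∧
              (A.filter fun x => ω ∈ Literature.Probability.Percolation.openConn o x).card ≤ j} ≤
        (Literature.Probability.LatticeModels.prodBernoulli w).real
          {ω : Literature.Probability.Percolation.BondConfig (Fin n) |
            (A.filter fun x => ω ∈ Literature.Probability.Percolation.openConn a x).card ≤ j ∧
              1 ≤ (A.filter fun x => ω ∈ Literature.Probability.Percolation.openConn o x).card}) :
    Summit.CriticalPhenomena.PercolationContinuityZ3.Theses.PercNearOneGluing.NoHeavyLowerTail :=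
  noHeavyLowerTail_of_attachedChampion fun n w A o q j ho hq hchamp =>
    attachedChampion_of_deleted_of_witnessTransfer hXZH hWT n w A o q j ho hq hchamp

end Summit.CriticalPhenomena.PercolationContinuityZ3.Theorems

end
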